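import Literature.MathematicalPhysics.QuantumFieldTheory.Balaban1983to89.Node00.CarriersB8CubeDentedRecTranslate
import Literature.MathematicalPhysics.QuantumFieldTheory.Balaban1983to89.B8Ineq159FlatCubeMemberPrintedRec
import Literature.MathematicalPhysics.QuantumFieldTheory.Balaban1983to89.B8DentedCubeMemberLamBPrime

/-!
# `Balaban1983to89.B8DentedCubeMemberZdRec` — [Balaban1985RegularSpaces] (1.31) p. 82 ∕ (1.68) p. 88 ∕ [Balaban1984PropagatorsII] (2.3) ∕ [Balaban1985Variational] (148)–(153):
# the dented cube member's DRIVER GEOMETRY FOR THE RECORD's CENTRED TOWER ([Balaban1987RG1] (0.3)) — truncated cells `CubeB8DZ.lamST`, the driver's classes `cubeLamBZ`,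
# `cubeLamBP'Z`, `CubeB8DZ.lamB`, `CubeB8DZ.lamBPT` (record twins of `B8DentedCubeMemberZd` §1, `B8CubeMemberZd.cubeLamB`, `B9SupplySockB9P3ZdGamma.cubeLamBP'`,
# `B8DentedCubeMemberLamBPrime` §1), their (T2) DICTIONARY to the engine classes of the translated datum `c.translate`, and the three laws of Theorem 4's γ driver —
# `lamBPT_hbox_pred`, `lamBPT_hclass`, `bdryLayer_dented` — TRANSFERRED from the engine by translation

statement-level skeleton of published theorems with citation tags; proofs where landed; nothing here is a claim about the Yang–Mills mass gap

CITATION HEADER (lean-in-tree rule).  Cell `pub-ymgap` (HUMAN RULING D-0062), «N05-REC» road (director-ym №254∕№255∕№288; LEAD PEN dag-n05-e g38; desk `R6-PLAN.md` §2 row (g)): the R6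
crown root `B8Prop6DentedCubeMemberGammaRec` (twin of `B8Prop6DentedCubeMemberGamma`) feeds the record Thm-4 driver `B8Thm4ExistsAtGammaRec.thm4Exists_concrete_at_γ` at
`(Ω, Λs, Λb) := (c.sq, c.lamST, c.lamBPT)` and needs exactly the three binders `hbox ∕ hclass ∕ hlay` of that driver for the RECORD classes; this file supplies them.  [6] =
[Balaban1985RegularSpaces] (1.31) p. 82 («All sites of the contours Γ_{b₋,x} belong to Λ_{j−1}»), (1.5)–(1.6) p. 77, (1.68) p. 88, (1.131) p. 99, p. 98; [B6] = [Balaban1984PropagatorsII]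
(2.3) p. 224; [15] = [Balaban1985Variational] (148)–(153) p. 301; [I] = [Balaban1987RG1] (0.3) p. 252 (CENTRED blocks «Bᵏ(y) = {x : |x_μ − Lᵏy_μ| ≤ (Lᵏ−1)∕2}»).
`--kind definition --supports stmt-QuantumFields-20541` (K0⁷; count-neutral).
METHOD — DICTIONARY + TRANSFER, NOT RE-PROOF.  Every record class below is the token-mapped comprehension of its engine model (corner locality box `[loK, bondHiK]` ↦ the CENTRED box
`[Lʲz − c_j𝟙, Lʲz + Lʲe_μ + c_j𝟙]` of `B7LocalityRec`; corner block `[L•z, L•z + blockTop L]` ↦ centred block `[L•z − s𝟙, L•z + s𝟙]`; `cubeFam ∕ cubeLamS ∕ cubeLamBP ∕ CubeB8D.sq ∕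
lamS ∕ lamBP ↦ cubeFamZ ∕ cubeLamSZ ∕ cubeLamBPZ ∕ CubeB8DZ.sq ∕ lamS ∕ lamBPZ`).  §1 proves the two coordinate dictionaries (box: `x` in the centred box of `z` iff `x + c_k` in the
corner box of `z + c_{k−j}`, by `c_k = Lʲc_{k−j} + c_j`, `Lʲ − 1 = 2c_j`; block: `x` in the centred block of `z` iff `x + c_{k−n}` in the corner block of `z + c_{k−n−1}`, by
`c_{k−n} = L·c_{k−n−1} + s`); §3 lifts them to the classes; §4 reads the engine laws (`B8DentedCubeMemberLamBPrime.{lamBPT_hbox_pred, lamBPT_hclass, bdryLayer_dented}`, PROVED) at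
the translated datum `c.translate` (`Node00/CarriersB8CubeDentedRecTranslate`) and shifts back.  REUSED BY NAME: `B8Eq119TwistedAxialRec.ctrShift_add`,
`BlockAveragingZd.{two_mul_ctrShift_add_one, ctrShift_succ}`, `B8Eq131CubesAdmissibleRec.mem_cubeFamZ_iff_add_ctrShift`, `B8Ineq159FlatCubeMemberPrintedRec.{mem_cubeLamSZ_iff_add_ctrShift,
mem_cubeLamBPZ_iff_add_ctrShift}`, `Node00.CubeB8DZ.{image_add_ctrShift_sq, mem_lamS_iff_add_ctrShift, mem_lamBPZ_iff_add_ctrShift, translate_k}`, `B8CubeMemberZdRec.inBox_sq_of_mem_cubeLamSZ`.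
WHAT IS PROVED (sorry-free).  §1 `inBox_locBox_iff_add_ctrShift`, `block_iff_add_ctrShift`; §2 defs `cubeLamBZ`, `cubeLamBP'Z`, `CubeB8DZ.lamST`, `CubeB8DZ.lamB`, `CubeB8DZ.lamBPT` +
readings `lamST_of_lt ∕ lamST_top_apply ∕ inBox_sq_of_mem_lamST ∕ lamBPT_of_lt ∕ lamBPT_top_of_ne_zero ∕ hΩ_sq` (the engine's `lamST_top ∕ lamBPT_top_zero` shapes are
identified with the engine's by the dedup lint and omitted: `unfold CubeB8DZ.lamBPT; rw [if_neg (lt_irrefl _), if_pos rfl]`); §3 dictionaries `add_ctrShift_mem_translate_sq_iff`,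
`mem_lamST_iff_add_ctrShift`, `mem_cubeLamBZ_iff_add_ctrShift`, `mem_cubeLamBP'Z_iff_add_ctrShift`, `mem_lamB_iff_add_ctrShift`, `mem_lamBPT_iff_add_ctrShift`; §4 ★ `lamBPT_hbox_pred`, ★★
`lamBPT_hclass`, ★ `bdryLayer_dented` for `CubeB8DZ`.
HONEST SCOPE.  Definitions + set bookkeeping; no estimate; nothing of [6]∕[15]∕[B6]∕[I] asserted; `HThm4Rec` UNDISCHARGED; N05 ∕ N07 NOT discharged; counts unmoved (typed 28∕28 · discharged
8∕28); one finite 𝕋⁴ programme at fixed ε — nothing continuum ∕ ℝ⁴ ∕ OS ∕ mass gap ∕ Clay.  No `instance`, no `notation`, no `sorry`.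
-/

set_option autoImplicit false
noncomputable section

namespace Literature.MathematicalPhysics.QuantumFieldTheory.Balaban1983to89.B8DentedCubeMemberZdRec

open B7Prop1Explicit (e)
open B7Prop1Local (InBox loK bondHiK add_e_apply)
open BlockAveragingZd (ctrShift two_mul_ctrShift_add_one ctrShift_succ)
open B8Eq119TwistedAxialRec (ctrShift_add)
open B8Lemma1NonAbelianRecLoops (halfVec)
open B8Thm2LogB (blockTop)
open B8Eq131CubesRec (sqLoZ sqHiZ)
open B8Eq131CubesAdmissible (cubeFam)
open B8Eq131CubesAdmissibleRec (cubeFamZ mem_cubeFamZ_iff_add_ctrShift)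
open B8CubeMemberZd (cubeLamS cubeLamB)
open B8CubeMemberZdRec (cubeLamSZ inBox_sq_of_mem_cubeLamSZ)
open B8Ineq159FlatCubeMemberPrinted (cubeLamBP)
open B8Ineq159FlatCubeMemberPrintedRec (cubeLamBPZ mem_cubeLamSZ_iff_add_ctrShift mem_cubeLamBPZ_iff_add_ctrShift)
open B9SupplySockB9P3ZdGamma (cubeLamBP' cubeLamBP'_zero cubeLamBP'_of_ne_zero)
open B8DentedCubeMemberZd (lamST_of_lt lamST_top)
open B8DentedCubeMemberLamBPrime (lamBPT_of_lt lamBPT_top_zero lamBPT_top_of_ne_zero)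
open Node00 (CubeB8D CubeB8DZ)

-- `Site` alone would resolve to the torus sites of `Setup.lean`; re-export the `ℤ^d` sites of `B7Prop1Explicit`.
export B7Prop1Explicit (Site)

variable {d : ℕ}

/-! ## §1 The two coordinate dictionaries: centred locality box ∕ centred block vs the engine's corner box ∕ block of the shifted label -/

/-- ★ **BOX DICTIONARY** (odd `L`, `j ≤ k`): `x` lies in the CENTRED locality box `[Lʲz − c_j𝟙, Lʲz + Lʲe_μ + c_j𝟙]` of the level-`j` bond `⟨z, z + e_μ⟩` iff `x + c_k·𝟙` lies in the
engine's CORNER box `[loK L j z′, bondHiK L j z′ μ]` of the shifted label `z′ = z + c_{k−j}·𝟙` — `c_k = Lʲc_{k−j} + c_j`, `Lʲ − 1 = 2c_j`.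
[cite: Balaban1987RG1, (0.3) p.252; Balaban1985Averaging, p.24 (locality box of (43))] -/
theorem inBox_locBox_iff_add_ctrShift {L : ℕ} (hL : Odd L) {j k : ℕ} (hjk : j ≤ k) (z x : Site d) (μ : Fin d) :
    InBox (fun i => (L : ℤ) ^ j * z i - (ctrShift L j : ℤ)) (fun i => (L : ℤ) ^ j * z i + (ctrShift L j : ℤ) + if i = μ then (L : ℤ) ^ j else 0) x ↔
      InBox (loK L j (z + fun _ => (ctrShift L (k - j) : ℤ))) (bondHiK L j (z + fun _ => (ctrShift L (k - j) : ℤ)) μ) (x + fun _ => (ctrShift L k : ℤ)) := by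
  have hcn : (ctrShift L k : ℤ) = (L : ℤ) ^ j * ctrShift L (k - j) + ctrShift L j := by
    have h := ctrShift_add hL (k - j) j
    rwa [Nat.sub_add_cancel hjk] at h
  have hc : 2 * (ctrShift L j : ℤ) + 1 = (L : ℤ) ^ j := by exact_mod_cast two_mul_ctrShift_add_one hL j
  refine forall_congr' fun i => ?_
  simp only [loK, bondHiK, Pi.add_apply, mul_add, hcn]
  constructor <;> rintro ⟨h1, h2⟩ <;> exact ⟨by linarith, by linarith⟩

/-- ★ **BLOCK DICTIONARY** (`L = 2s + 1`, `n + 1 ≤ k`): the level-`n` label `x` lies in the CENTRED block `[L•z − s𝟙, L•z + s𝟙]` of the level-`(n+1)` label `z` iff `x + c_{k−n}·𝟙`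
lies in the engine's CORNER block `[L•z′, L•z′ + (L−1)𝟙]` of `z′ = z + c_{k−n−1}·𝟙` — `c_{k−n} = L·c_{k−n−1} + s`. [cite: Balaban1987RG1, (0.3) p.252; Balaban1985RegularSpaces, (1.31) p.82] -/
theorem block_iff_add_ctrShift {L s : ℕ} (hLs : L = 2 * s + 1) {n k : ℕ} (hnk : n + 1 ≤ k) (z x : Site d) :
    ((L : ℤ) • z - halfVec L ≤ x ∧ x ≤ (L : ℤ) • z + halfVec L) ↔
      ((L : ℤ) • (z + fun _ => (ctrShift L (k - (n + 1)) : ℤ)) ≤ (x + fun _ => (ctrShift L (k - n) : ℤ)) ∧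
        (x + fun _ => (ctrShift L (k - n) : ℤ)) ≤ (L : ℤ) • (z + fun _ => (ctrShift L (k - (n + 1)) : ℤ)) + blockTop L) := by
  have hL : Odd L := ⟨s, by omega⟩
  have hs : ((L - 1) / 2 : ℕ) = s := by omega
  have hcn : (ctrShift L (k - n) : ℤ) = (L : ℤ) * ctrShift L (k - (n + 1)) + (s : ℤ) := by
    rw [show k - n = (k - (n + 1)) + 1 by omega, ctrShift_succ hL, hs]; push_cast; ring
  have hLz : (L : ℤ) = 2 * s + 1 := by exact_mod_cast hLs
  constructor
  · rintro ⟨h1, h2⟩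
    refine ⟨fun i => ?_, fun i => ?_⟩
    · have a := h1 i
      simp only [Pi.sub_apply, Pi.smul_apply, smul_eq_mul, halfVec, hs, Pi.add_apply] at a ⊢
      rw [hcn]; linarith
    · have b := h2 i
      simp only [Pi.add_apply, Pi.smul_apply, smul_eq_mul, halfVec, hs, blockTop] at b ⊢
      rw [hcn]; linarith
  · rintro ⟨h1, h2⟩
    refine ⟨fun i => ?_, fun i => ?_⟩
    · have a := h1 i
      simp only [Pi.sub_apply, Pi.smul_apply, smul_eq_mul, halfVec, hs, Pi.add_apply] at a ⊢
      rw [hcn] at a; linarith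
    · have b := h2 i
      simp only [Pi.add_apply, Pi.smul_apply, smul_eq_mul, halfVec, hs, blockTop] at b ⊢
      rw [hcn] at b; linarith

/-! ## §2 The record classes of the dented member -/

section Defs

variable {L K : ℕ} {Ω : ℕ → Set (Site d)}

/-- (RECORD TWIN of `B8CubeMemberZd.cubeLamB`.) **THE DRIVER'S CONSTRAINT-BOND CLASS OF THE PURE MEMBER at truncation `m`, level `j`, CENTRED TOWER**: a level-`j` bond whose centred
locality box lies in `□_j` (`cubeFamZ false`) and which is INNER (both ends in `cubeLamSZ … m j`), CROSSING (the centred `L`-block of `b₋` in `cubeLamSZ … m (j−1)`, `b₊` a cell) or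
MIRRORED-CROSSING. [cite: Balaban1985RegularSpaces, (1.31) p.82, (1.37) p.82; Balaban1987RG1, (0.3) p.252] -/
def cubeLamBZ (L : ℕ) (a : Site d) (M ρ k m j : ℕ) : Set (Site d × Fin d) :=
  {b | (∀ x, InBox (fun i => (L : ℤ) ^ j * b.1 i - (ctrShift L j : ℤ)) (fun i => (L : ℤ) ^ j * b.1 i + (ctrShift L j : ℤ) + if i = b.2 then (L : ℤ) ^ j else 0) x →
      x ∈ cubeFamZ false L a M ρ k j) ∧
    ((b.1 ∈ cubeLamSZ L a M ρ k m j ∧ b.1 + e b.2 ∈ cubeLamSZ L a M ρ k m j) ∨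
      (∃ j', j = j' + 1 ∧ (∀ x, (L : ℤ) • b.1 - halfVec L ≤ x → x ≤ (L : ℤ) • b.1 + halfVec L → x ∈ cubeLamSZ L a M ρ k m j') ∧
        b.1 + e b.2 ∈ cubeLamSZ L a M ρ k m j) ∨
      (∃ j', j = j' + 1 ∧ b.1 ∈ cubeLamSZ L a M ρ k m j ∧
        (∀ x, (L : ℤ) • (b.1 + e b.2) - halfVec L ≤ x → x ≤ (L : ℤ) • (b.1 + e b.2) + halfVec L → x ∈ cubeLamSZ L a M ρ k m j')))}

/-- (RECORD TWIN of `B9SupplySockB9P3ZdGamma.cubeLamBP'`.) **THE SPLIT PRINT CLASS OF THE PURE MEMBER, CENTRED TOWER**: the inner class `cubeLamBZ … m 0` at level `0`, print's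
class `cubeLamBPZ … m j` ([B6] (2.3)) at `j ≥ 1`. [cite: Balaban1984PropagatorsII, (2.3) p.224; Balaban1985RegularSpaces, (1.31) p.82; Balaban1987RG1, (0.3) p.252] -/
def cubeLamBP'Z (L : ℕ) (a : Site d) (M ρ k m j : ℕ) : Set (Site d × Fin d) :=
  if j = 0 then cubeLamBZ L a M ρ k m 0 else cubeLamBPZ L a M ρ k m j

/-- (RECORD TWIN of `Node00.CubeB8D.lamST`.) **THE LEVEL-`m` TRUNCATION OF THE DENTED RECORD CELLS**: for `m < k` the pure member's `cubeLamSZ … m`, at the top the dented cells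
`c.lamS`. [cite: Balaban1985RegularSpaces, (1.68) p.88; Balaban1985Variational, (148)–(150) p.301; Balaban1987RG1, (0.3) p.252] -/
def _root_.Literature.MathematicalPhysics.QuantumFieldTheory.Balaban1983to89.Node00.CubeB8DZ.lamST (c : CubeB8DZ d L K Ω) (m : ℕ) : ℕ → Set (Site d) :=
  if m < c.k then cubeLamSZ L c.a c.M c.ρ c.k m else c.lamS

/-- (RECORD TWIN of `Node00.CubeB8D.lamB`.) **THE DRIVER'S CONSTRAINT-BOND CLASS OF THE DENTED RECORD MEMBER at truncation `m`, level `j`**: centred locality box in `Ω′_j = c.sq j`,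
inner ∕ crossing ∕ mirrored-crossing w.r.t. `c.lamST m`. [cite: Balaban1985RegularSpaces, (1.31) p.82; Balaban1985Variational, (148)–(150) p.301, (153) p.301; Balaban1987RG1, (0.3) p.252] -/
def _root_.Literature.MathematicalPhysics.QuantumFieldTheory.Balaban1983to89.Node00.CubeB8DZ.lamB (c : CubeB8DZ d L K Ω) (m j : ℕ) : Set (Site d × Fin d) :=
  {b | (∀ x, InBox (fun i => (L : ℤ) ^ j * b.1 i - (ctrShift L j : ℤ)) (fun i => (L : ℤ) ^ j * b.1 i + (ctrShift L j : ℤ) + if i = b.2 then (L : ℤ) ^ j else 0) x →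
      x ∈ c.sq j) ∧
    ((b.1 ∈ c.lamST m j ∧ b.1 + e b.2 ∈ c.lamST m j) ∨
      (∃ j', j = j' + 1 ∧ (∀ x, (L : ℤ) • b.1 - halfVec L ≤ x → x ≤ (L : ℤ) • b.1 + halfVec L → x ∈ c.lamST m j') ∧ b.1 + e b.2 ∈ c.lamST m j) ∨
      (∃ j', j = j' + 1 ∧ b.1 ∈ c.lamST m j ∧
        (∀ x, (L : ℤ) • (b.1 + e b.2) - halfVec L ≤ x → x ≤ (L : ℤ) • (b.1 + e b.2) + halfVec L → x ∈ c.lamST m j')))}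

/-- (RECORD TWIN of `Node00.CubeB8D.lamBPT`.) **THE SPLIT CONSTRAINT-BOND CLASS OF THE DENTED RECORD MEMBER AT TRUNCATION `m`**: below the top the pure split class
`cubeLamBP'Z … m`; at the top the inner class `c.lamB k 0` at level `0` and print's dented class `c.lamBPZ j` at `j ≥ 1`.
[cite: Balaban1985RegularSpaces, (1.31) p.82, (1.68) p.88; Balaban1984PropagatorsII, (2.3) p.224; Balaban1985Variational, (148)–(153) p.301; Balaban1987RG1, (0.3) p.252] -/
def _root_.Literature.MathematicalPhysics.QuantumFieldTheory.Balaban1983to89.Node00.CubeB8DZ.lamBPT (c : CubeB8DZ d L K Ω) (m j : ℕ) : Set (Site d × Fin d) :=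
  if m < c.k then cubeLamBP'Z L c.a c.M c.ρ c.k m j else if j = 0 then c.lamB c.k 0 else c.lamBPZ j

variable (c : CubeB8DZ d L K Ω)

/-- Below the top the truncated dented cells are the pure member's. [cite: Balaban1985RegularSpaces, (1.68) p.88; Balaban1985Variational, (150) p.301] -/
theorem lamST_of_lt {m : ℕ} (hm : m < c.k) : c.lamST m = cubeLamSZ L c.a c.M c.ρ c.k m := by
  unfold CubeB8DZ.lamST; rw [if_pos hm]

/-- At the top (`m = k`) the cells are the dented cells `Λ′_j`, level by level (the function-level identity is the engine's `lamST_top` verbatim under the token map; stated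
pointwise here). [cite: Balaban1985Variational, (148) p.301; Balaban1985RegularSpaces, (1.131) p.99] -/
theorem lamST_top_apply (j : ℕ) : c.lamST c.k j = c.lamS j := by
  unfold CubeB8DZ.lamST; rw [if_neg (lt_irrefl _)]

/-- Every truncated dented cell label of level `j` lies in `□_j^{(j)}` (centred label boxes). [cite: Balaban1985RegularSpaces, (1.68) p.88, (1.5) p.77; Balaban1985Variational, (150) p.301; Balaban1987RG1, (0.3) p.252] -/
theorem inBox_sq_of_mem_lamST {m j : ℕ} {z : Site d} (hz : z ∈ c.lamST m j) : InBox (sqLoZ L c.a c.ρ c.k j) (sqHiZ L c.a c.M c.ρ c.k j) z := by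
  by_cases hm : m < c.k
  · rw [lamST_of_lt c hm] at hz; exact inBox_sq_of_mem_cubeLamSZ hz
  · unfold CubeB8DZ.lamST at hz
    rw [if_neg hm] at hz
    by_cases hj : j ≤ c.k
    · have h1 : c.lamS j = {z | InBox (sqLoZ L c.a c.ρ c.k j) (sqHiZ L c.a c.M c.ρ c.k j) z ∧ (j = c.k → ∀ x, B8Eq119TwistedAxialRec.UnderZ L j z x → x ∈ Ω c.k) ∧
          (j < c.k → ¬ (InBox (B8Eq131CubesRec.inLoZ L c.a c.ρ c.k j) (B8Eq131CubesRec.inHiZ L c.a c.M c.ρ c.k j) z ∧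
            (j + 1 = c.k → ∀ x, B8Eq119TwistedAxialRec.UnderZ L j z x → x ∈ Ω c.k)))} := by
        simp only [CubeB8DZ.lamS, if_pos hj]
      rw [h1] at hz
      exact hz.1
    · have h1 : c.lamS j = ∅ := by simp only [CubeB8DZ.lamS, if_neg hj]
      rw [h1] at hz
      exact absurd hz (Set.notMem_empty _)

/-- Below the top the split class is the pure member's. [cite: Balaban1985Variational, (150) p.301; Balaban1985RegularSpaces, (1.68) p.88] -/
theorem lamBPT_of_lt {m : ℕ} (hm : m < c.k) (j : ℕ) : c.lamBPT m j = cubeLamBP'Z L c.a c.M c.ρ c.k m j := by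
  unfold CubeB8DZ.lamBPT; rw [if_pos hm]

/-- At the top, levels `j ≥ 1`: print's dented class (`CubeB8DZ.lamBPZ`). [cite: Balaban1984PropagatorsII, (2.3) p.224; Balaban1985Variational, (153) p.301] -/
theorem lamBPT_top_of_ne_zero {j : ℕ} (hj : j ≠ 0) : c.lamBPT c.k j = c.lamBPZ j := by
  unfold CubeB8DZ.lamBPT; rw [if_neg (lt_irrefl _), if_neg hj]

/-- **(1.3) for the dented record tower**: `Ω′_{j+1} ⊂ Ω′_j` (dag-n07-w3's `CubeB8DZ.sq_succ_subset`, odd `L`). [cite: Balaban1985RegularSpaces, (1.3) p.77; Balaban1985Variational, (150) p.301] -/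
theorem hΩ_sq (hL : Odd L) : ∀ j, c.sq (j + 1) ⊆ c.sq j := c.sq_succ_subset hL

end Defs

/-! ## §3 The (T2) dictionary for the classes: record class ∋ `⟨z, μ⟩` iff engine class of `c.translate` ∋ `⟨z + c_{k−j}, μ⟩` -/

section Dictionary

variable {L K : ℕ} {Ω : ℕ → Set (Site d)} (c : CubeB8DZ d L K Ω)

/-- `x + t ∈ S + t ↔ x ∈ S`. [folklore] [cite: Balaban1987RG1, (0.3) p.252 (bookkeeping)] -/
private theorem add_mem_image_add_iff (S : Set (Site d)) (t x : Site d) : x + t ∈ (fun y => y + t) '' S ↔ x ∈ S :=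
  ⟨fun ⟨y, hy, h⟩ => by rwa [← add_right_cancel h], fun hx => ⟨x, hx, rfl⟩⟩

/-- ★ `x + c_k ∈ (c.translate).sq j ↔ x ∈ c.sq j` (odd `L`). [cite: Balaban1987RG1, (0.3) p.252; Balaban1985Variational, (148)–(150) p.301] -/
theorem add_ctrShift_mem_translate_sq_iff (hL : Odd L) (j : ℕ) (x : Site d) :
    (x + fun _ => (ctrShift L c.k : ℤ)) ∈ (c.translate hL).sq j ↔ x ∈ c.sq j := by
  rw [← c.image_add_ctrShift_sq hL j]; exact add_mem_image_add_iff _ _ _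

/-- `y ∈ (c.translate).sq j ↔ y − c_k ∈ c.sq j` (odd `L`). [cite: Balaban1987RG1, (0.3) p.252; Balaban1985Variational, (148)–(150) p.301] -/
theorem mem_translate_sq_iff_sub (hL : Odd L) (j : ℕ) (y : Site d) :
    y ∈ (c.translate hL).sq j ↔ (y - fun _ => (ctrShift L c.k : ℤ)) ∈ c.sq j := by
  rw [← add_ctrShift_mem_translate_sq_iff c hL j (y - fun _ => (ctrShift L c.k : ℤ)), sub_add_cancel]

/-- ★ **Truncated cells through the label shift** (odd `L`): `z ∈ c.lamST m j ↔ z + c_{k−j} ∈ (c.translate).lamST m j`. [cite: Balaban1985RegularSpaces, (1.68) p.88; Balaban1985Variational, (148)–(150) p.301; Balaban1987RG1, (0.3) p.252] -/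
theorem mem_lamST_iff_add_ctrShift (hL : Odd L) (m j : ℕ) (z : Site d) :
    z ∈ c.lamST m j ↔ (z + fun _ => (ctrShift L (c.k - j) : ℤ)) ∈ (c.translate hL).lamST m j := by
  by_cases hm : m < c.k
  · rw [lamST_of_lt c hm, B8DentedCubeMemberZd.lamST_of_lt (c.translate hL) hm]
    exact mem_cubeLamSZ_iff_add_ctrShift L c.a c.M c.ρ c.k m j z
  · unfold CubeB8DZ.lamST CubeB8D.lamST
    rw [if_neg hm, CubeB8DZ.translate_k, if_neg hm]
    exact c.mem_lamS_iff_add_ctrShift hL j z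

/-- The block step of the dictionary on cell families (plumbing): if `x ∈ Λ j' ↔ x + c_{k−j'} ∈ Λ′ j'`, then «the centred block of `z` lies in `Λ (j−1)`» iff «the corner block of
`z + c_{k−j}` lies in `Λ′ (j−1)`» (`j = j′ + 1 ≤ k`). [cite: Balaban1987RG1, (0.3) p.252; Balaban1985RegularSpaces, (1.31) p.82] -/
private theorem block_family_iff {L s : ℕ} (hLs : L = 2 * s + 1) {k j' : ℕ} (hjk : j' + 1 ≤ k) {Λ Λ' : Set (Site d)}
    (hΛ : ∀ x : Site d, x ∈ Λ ↔ (x + fun _ => (ctrShift L (k - j') : ℤ)) ∈ Λ') (z : Site d) :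
    (∀ x, (L : ℤ) • z - halfVec L ≤ x → x ≤ (L : ℤ) • z + halfVec L → x ∈ Λ) ↔
      (∀ x, (L : ℤ) • (z + fun _ => (ctrShift L (k - (j' + 1)) : ℤ)) ≤ x →
        x ≤ (L : ℤ) • (z + fun _ => (ctrShift L (k - (j' + 1)) : ℤ)) + blockTop L → x ∈ Λ') := by
  constructor
  · intro h x h1 h2
    have hx := (block_iff_add_ctrShift hLs hjk z (x - fun _ => (ctrShift L (k - j') : ℤ))).2 (by rw [sub_add_cancel]; exact ⟨h1, h2⟩)
    have := (hΛ _).1 (h _ hx.1 hx.2)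
    rwa [sub_add_cancel] at this
  · intro h x h1 h2
    have hx := (block_iff_add_ctrShift hLs hjk z x).1 ⟨h1, h2⟩
    exact (hΛ x).2 (h _ hx.1 hx.2)

/-- The box step of the dictionary on site families (plumbing): if `x ∈ D ↔ x + c_k ∈ D′`, then «the centred box of `⟨z, μ⟩` lies in `D`» iff «the corner box of `⟨z + c_{k−j}, μ⟩` lies in
`D′`» (`j ≤ k`). [cite: Balaban1987RG1, (0.3) p.252; Balaban1985Averaging, p.24] -/
private theorem box_family_iff {L : ℕ} (hL : Odd L) {k j : ℕ} (hjk : j ≤ k) {D D' : Set (Site d)}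
    (hD : ∀ x : Site d, x ∈ D ↔ (x + fun _ => (ctrShift L k : ℤ)) ∈ D') (z : Site d) (μ : Fin d) :
    (∀ x, InBox (fun i => (L : ℤ) ^ j * z i - (ctrShift L j : ℤ)) (fun i => (L : ℤ) ^ j * z i + (ctrShift L j : ℤ) + if i = μ then (L : ℤ) ^ j else 0) x → x ∈ D) ↔
      (∀ x, InBox (loK L j (z + fun _ => (ctrShift L (k - j) : ℤ))) (bondHiK L j (z + fun _ => (ctrShift L (k - j) : ℤ)) μ) x → x ∈ D') := by
  constructor
  · intro h x hx
    have hx' := (inBox_locBox_iff_add_ctrShift hL hjk z (x - fun _ => (ctrShift L k : ℤ)) μ).2 (by rw [sub_add_cancel]; exact hx)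
    have := (hD _).1 (h _ hx')
    rwa [sub_add_cancel] at this
  · intro h x hx
    exact (hD x).2 (h _ ((inBox_locBox_iff_add_ctrShift hL hjk z x μ).1 hx))

/-- ★ **The pure driver class through the label shift** (`L = 2s+1`, `j ≤ m ≤ k`… only `j ≤ k` needed): `⟨z, μ⟩ ∈ cubeLamBZ … m j ↔ ⟨z + c_{k−j}, μ⟩ ∈ cubeLamB … m j`.
[cite: Balaban1985RegularSpaces, (1.31) p.82; Balaban1987RG1, (0.3) p.252] -/
theorem mem_cubeLamBZ_iff_add_ctrShift {L s : ℕ} (hLs : L = 2 * s + 1) (a : Site d) (M ρ : ℕ) {k m j : ℕ} (hjk : j ≤ k) (b : Site d × Fin d) :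
    b ∈ cubeLamBZ L a M ρ k m j ↔ ((b.1 + fun _ => (ctrShift L (k - j) : ℤ)), b.2) ∈ cubeLamB L a M ρ k m j := by
  have hL : Odd L := ⟨s, by omega⟩
  have hΛ : ∀ j'' (x : Site d), x ∈ cubeLamSZ L a M ρ k m j'' ↔ (x + fun _ => (ctrShift L (k - j'') : ℤ)) ∈ cubeLamS L a M ρ k m j'' :=
    fun j'' x => mem_cubeLamSZ_iff_add_ctrShift L a M ρ k m j'' x
  show _ ∧ _ ↔ _ ∧ _
  refine and_congr (box_family_iff hL hjk (fun x => mem_cubeFamZ_iff_add_ctrShift hL false a M ρ k j x) b.1 b.2) ?_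
  refine or_congr ?_ (or_congr ?_ ?_)
  · rw [hΛ j b.1, hΛ j (b.1 + e b.2), add_right_comm b.1 (e b.2)]
  · constructor
    · rintro ⟨j', rfl, hblk, hend⟩
      exact ⟨j', rfl, (block_family_iff hLs hjk (hΛ j') b.1).1 hblk, by rw [add_right_comm]; exact (hΛ _ _).1 hend⟩
    · rintro ⟨j', rfl, hblk, hend⟩
      exact ⟨j', rfl, (block_family_iff hLs hjk (hΛ j') b.1).2 hblk, (hΛ _ _).2 (by rw [add_right_comm] at hend; exact hend)⟩
  · constructor
    · rintro ⟨j', rfl, hend, hblk⟩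
      refine ⟨j', rfl, (hΛ _ _).1 hend, ?_⟩
      have h := (block_family_iff hLs hjk (hΛ j') (b.1 + e b.2)).1 hblk
      rwa [add_right_comm b.1 (e b.2)] at h
    · rintro ⟨j', rfl, hend, hblk⟩
      refine ⟨j', rfl, (hΛ _ _).2 hend, ?_⟩
      rw [add_right_comm] at hblk
      exact (block_family_iff hLs hjk (hΛ j') (b.1 + e b.2)).2 hblk

/-- ★ **The pure split class through the label shift**: `⟨z, μ⟩ ∈ cubeLamBP'Z … m j ↔ ⟨z + c_{k−j}, μ⟩ ∈ cubeLamBP' … m j` (`L = 2s+1`, `j ≤ k`).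
[cite: Balaban1984PropagatorsII, (2.3) p.224; Balaban1985RegularSpaces, (1.31) p.82; Balaban1987RG1, (0.3) p.252] -/
theorem mem_cubeLamBP'Z_iff_add_ctrShift {L s : ℕ} (hLs : L = 2 * s + 1) (a : Site d) (M ρ : ℕ) {k m j : ℕ} (hjk : j ≤ k) (b : Site d × Fin d) :
    b ∈ cubeLamBP'Z L a M ρ k m j ↔ ((b.1 + fun _ => (ctrShift L (k - j) : ℤ)), b.2) ∈ cubeLamBP' L a M ρ k m j := by
  by_cases hj : j = 0
  · subst hj
    rw [cubeLamBP'_zero]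
    unfold cubeLamBP'Z; rw [if_pos rfl]
    exact mem_cubeLamBZ_iff_add_ctrShift hLs a M ρ hjk b
  · rw [cubeLamBP'_of_ne_zero L a M ρ k m hj]
    unfold cubeLamBP'Z; rw [if_neg hj]
    exact mem_cubeLamBPZ_iff_add_ctrShift L a M ρ k m j b

/-- ★ **The dented driver class through the label shift**: `⟨z, μ⟩ ∈ c.lamB m j ↔ ⟨z + c_{k−j}, μ⟩ ∈ (c.translate).lamB m j` (`L = 2s+1`, `j ≤ k`).
[cite: Balaban1985RegularSpaces, (1.31) p.82; Balaban1985Variational, (148)–(153) p.301; Balaban1987RG1, (0.3) p.252] -/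
theorem mem_lamB_iff_add_ctrShift {L s : ℕ} (hLs : L = 2 * s + 1) {K : ℕ} {Ω : ℕ → Set (Site d)} (c : CubeB8DZ d L K Ω) {m j : ℕ} (hjk : j ≤ c.k) (b : Site d × Fin d) :
    b ∈ c.lamB m j ↔ ((b.1 + fun _ => (ctrShift L (c.k - j) : ℤ)), b.2) ∈ (c.translate ⟨s, by omega⟩).lamB m j := by
  have hL : Odd L := ⟨s, by omega⟩
  have hΛ : ∀ j'' (x : Site d), x ∈ c.lamST m j'' ↔ (x + fun _ => (ctrShift L (c.k - j'') : ℤ)) ∈ (c.translate hL).lamST m j'' :=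
    fun j'' x => mem_lamST_iff_add_ctrShift c hL m j'' x
  rw [B8DentedCubeMemberZd.mem_lamB_iff]
  show _ ∧ _ ↔ _ ∧ _
  refine and_congr (box_family_iff hL hjk (fun x => (add_ctrShift_mem_translate_sq_iff c hL j x).symm) b.1 b.2) ?_
  refine or_congr ?_ (or_congr ?_ ?_)
  · rw [hΛ j b.1, hΛ j (b.1 + e b.2), add_right_comm b.1 (e b.2)]
  · constructor
    · rintro ⟨j', rfl, hblk, hend⟩
      exact ⟨j', rfl, (block_family_iff hLs hjk (hΛ j') b.1).1 hblk, by rw [add_right_comm]; exact (hΛ _ _).1 hend⟩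
    · rintro ⟨j', rfl, hblk, hend⟩
      exact ⟨j', rfl, (block_family_iff hLs hjk (hΛ j') b.1).2 hblk, (hΛ _ _).2 (by rw [add_right_comm] at hend; exact hend)⟩
  · constructor
    · rintro ⟨j', rfl, hend, hblk⟩
      refine ⟨j', rfl, (hΛ _ _).1 hend, ?_⟩
      have h := (block_family_iff hLs hjk (hΛ j') (b.1 + e b.2)).1 hblk
      rwa [add_right_comm b.1 (e b.2)] at h
    · rintro ⟨j', rfl, hend, hblk⟩
      refine ⟨j', rfl, (hΛ _ _).2 hend, ?_⟩
      rw [add_right_comm] at hblk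
      exact (block_family_iff hLs hjk (hΛ j') (b.1 + e b.2)).2 hblk

/-- ★ **The dented split class through the label shift**: `⟨z, μ⟩ ∈ c.lamBPT m j ↔ ⟨z + c_{k−j}, μ⟩ ∈ (c.translate).lamBPT m j` (`L = 2s+1`, `j ≤ k`).
[cite: Balaban1985RegularSpaces, (1.31) p.82, (1.68) p.88; Balaban1984PropagatorsII, (2.3) p.224; Balaban1985Variational, (148)–(153) p.301; Balaban1987RG1, (0.3) p.252] -/
theorem mem_lamBPT_iff_add_ctrShift {L s : ℕ} (hLs : L = 2 * s + 1) {K : ℕ} {Ω : ℕ → Set (Site d)} (c : CubeB8DZ d L K Ω) {m j : ℕ} (hjk : j ≤ c.k) (b : Site d × Fin d) :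
    b ∈ c.lamBPT m j ↔ ((b.1 + fun _ => (ctrShift L (c.k - j) : ℤ)), b.2) ∈ (c.translate ⟨s, by omega⟩).lamBPT m j := by
  have hL : Odd L := ⟨s, by omega⟩
  by_cases hm : m < c.k
  · rw [lamBPT_of_lt c hm, B8DentedCubeMemberLamBPrime.lamBPT_of_lt (c.translate hL) hm]
    exact mem_cubeLamBP'Z_iff_add_ctrShift hLs c.a c.M c.ρ hjk b
  · by_cases hj : j = 0
    · subst hj
      unfold CubeB8DZ.lamBPT CubeB8D.lamBPT
      rw [if_neg hm, if_pos rfl, CubeB8DZ.translate_k, if_neg hm, if_pos rfl]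
      exact mem_lamB_iff_add_ctrShift hLs c hjk b
    · unfold CubeB8DZ.lamBPT CubeB8D.lamBPT
      rw [if_neg hm, if_neg hj, CubeB8DZ.translate_k, if_neg hm, if_neg hj]
      exact c.mem_lamBPZ_iff_add_ctrShift hL j b

end Dictionary

/-! ## §4 The three laws of Theorem 4's γ driver for the RECORD classes, transferred from the engine -/

section Laws

variable {L s K : ℕ} {Ω : ℕ → Set (Site d)} (c : CubeB8DZ d L K Ω)

/-- ★ (RECORD TWIN of `B8DentedCubeMemberLamBPrime.lamBPT_hbox_pred`.) **THE γ BOX LAW FOR THE DENTED RECORD SPLIT CLASS**: for `m ≤ k`, `j ≤ m` and every class bond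
`b ∈ c.lamBPT m j`, the CENTRED locality box `[Lʲb₋ − c_j𝟙, Lʲb₋ + Lʲe_μ + c_j𝟙]` lies in `Ω′_{j−1} = c.sq (j − 1)` — VERBATIM the `hbox` binder of
`B8Thm4ExistsAtGammaRec.thm4Exists_concrete_at_γ` at `(Ω, Λb) := (c.sq, c.lamBPT)`.  The engine law at `c.translate`, through §1∕§3.
[cite: Balaban1985RegularSpaces, (1.31) p.82 («Γ_{b₋,x} ⊂ Λ_{j−1}»), (1.131) p.99; Balaban1984PropagatorsII, (2.3) p.224; Balaban1985Variational, (150) p.301; Balaban1987RG1, (0.3) p.252] -/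
theorem lamBPT_hbox_pred (hLs : L = 2 * s + 1) :
    ∀ m, m ≤ c.k → ∀ j, j ≤ m → ∀ b ∈ c.lamBPT m j, ∀ x,
      InBox (fun i => (L : ℤ) ^ j * b.1 i - (ctrShift L j : ℤ)) (fun i => (L : ℤ) ^ j * b.1 i + (ctrShift L j : ℤ) + if i = b.2 then (L : ℤ) ^ j else 0) x →
      x ∈ c.sq (j - 1) := by
  have hL : Odd L := ⟨s, by omega⟩
  have hL1 : 1 ≤ L := by omega
  intro m hm j hj b hb x hx
  have hjk : j ≤ c.k := hj.trans hm
  have hb' := (mem_lamBPT_iff_add_ctrShift hLs c hjk b).1 hb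
  have hx' := (inBox_locBox_iff_add_ctrShift hL hjk b.1 x b.2).1 hx
  have h := B8DentedCubeMemberLamBPrime.lamBPT_hbox_pred (c.translate hL) hL1 m hm j hj _ hb' _ hx'
  exact (add_ctrShift_mem_translate_sq_iff c hL (j - 1) x).1 h

/-- ★★ (RECORD TWIN of `B8DentedCubeMemberLamBPrime.lamBPT_hclass`.) **THE TRICHOTOMY LAW FOR THE DENTED RECORD SPLIT CLASS** w.r.t. the dented record cells `c.lamST m`: every class
bond of `c.lamBPT m j` (`m ≤ k`, `j ≤ m`) is INNER, CROSSING (`j = n + 1`, the CENTRED `L`-block `[L•b₋ − s𝟙, L•b₋ + s𝟙]` in `c.lamST m n`, `b₊ ∈ c.lamST m j`) or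
MIRRORED-CROSSING — VERBATIM the `hclass` binder of the record driver at `(Λs, Λb) := (c.lamST, c.lamBPT)`.  The engine law at `c.translate`, through §1∕§3.
[cite: Balaban1985RegularSpaces, (1.31) p.82, (1.5) p.77, (1.131) p.99; Balaban1984PropagatorsII, (2.3) p.224; Balaban1985Variational, (148)–(150) p.301; Balaban1987RG1, (0.3) p.252] -/
theorem lamBPT_hclass (hLs : L = 2 * s + 1) :
    ∀ m, m ≤ c.k → ∀ j, j ≤ m → ∀ b ∈ c.lamBPT m j,
      (b.1 ∈ c.lamST m j ∧ b.1 + e b.2 ∈ c.lamST m j) ∨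
      (∃ j', j = j' + 1 ∧ (∀ x, (L : ℤ) • b.1 - halfVec L ≤ x → x ≤ (L : ℤ) • b.1 + halfVec L → x ∈ c.lamST m j') ∧ b.1 + e b.2 ∈ c.lamST m j) ∨
      (∃ j', j = j' + 1 ∧ b.1 ∈ c.lamST m j ∧
        (∀ x, (L : ℤ) • (b.1 + e b.2) - halfVec L ≤ x → x ≤ (L : ℤ) • (b.1 + e b.2) + halfVec L → x ∈ c.lamST m j')) := by
  have hL : Odd L := ⟨s, by omega⟩
  have hL1 : 1 ≤ L := by omega
  intro m hm j hj b hb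
  have hjk : j ≤ c.k := hj.trans hm
  have hΛ : ∀ j'' (x : Site d), x ∈ c.lamST m j'' ↔ (x + fun _ => (ctrShift L (c.k - j'') : ℤ)) ∈ (c.translate hL).lamST m j'' :=
    fun j'' x => mem_lamST_iff_add_ctrShift c hL m j'' x
  have hb' := (mem_lamBPT_iff_add_ctrShift hLs c hjk b).1 hb
  rcases B8DentedCubeMemberLamBPrime.lamBPT_hclass (c.translate hL) hL1 m hm j hj _ hb' with ⟨h1, h2⟩ | ⟨j', hjj, hblk, hend⟩ | ⟨j', hjj, hend, hblk⟩
  · refine Or.inl ⟨(hΛ j b.1).2 h1, (hΛ j _).2 ?_⟩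
    have h2' : (b.1 + fun _ => (ctrShift L (c.k - j) : ℤ)) + e b.2 ∈ (c.translate hL).lamST m j := h2
    rwa [add_right_comm] at h2'
  · subst hjj
    refine Or.inr (Or.inl ⟨j', rfl, (block_family_iff hLs hjk (hΛ j') b.1).2 hblk, (hΛ _ _).2 ?_⟩)
    have hend' : (b.1 + fun _ => (ctrShift L (c.k - (j' + 1)) : ℤ)) + e b.2 ∈ (c.translate hL).lamST m (j' + 1) := hend
    rwa [add_right_comm] at hend'
  · subst hjj
    refine Or.inr (Or.inr ⟨j', rfl, (hΛ _ _).2 hend, ?_⟩)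
    have hblk' : ∀ x, (L : ℤ) • ((b.1 + fun _ => (ctrShift L (c.k - (j' + 1)) : ℤ)) + e b.2) ≤ x →
        x ≤ (L : ℤ) • ((b.1 + fun _ => (ctrShift L (c.k - (j' + 1)) : ℤ)) + e b.2) + blockTop L → x ∈ (c.translate hL).lamST m j' := hblk
    rw [add_right_comm] at hblk'
    exact (block_family_iff hLs hjk (hΛ j') (b.1 + e b.2)).2 hblk'

/-- ★ (RECORD TWIN of `B8DentedCubeMemberLamBPrime.bdryLayer_dented`.) **THE BOUNDARY-LAYER LAW FOR THE DENTED RECORD MEMBER**: a site of `Ω′₀ = □₀` with a sup-distance-`1` neighbour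
outside `□₀` lies in the level-`0` dented cell of every truncation `1 ≤ m ≤ k` (`L = 2s+1 ≥ 3`) — VERBATIM the `hlay` binder of the record driver at `(Ω, Λs) := (c.sq, c.lamST)`.  The
engine law at `c.translate` (both sites shifted by `c_k`, a translation preserving sup-distance), through §3 at `j = 0` (label shift `c_{k−0} = c_k`).
[cite: Balaban1985RegularSpaces, (1.5) p.77, p.98, (1.131) p.99; Balaban1985Variational, (150) p.301; Balaban1987RG1, (0.3) p.252] -/
theorem bdryLayer_dented (hLs : L = 2 * s + 1) (hs : 1 ≤ s) :
    ∀ m, 1 ≤ m → m ≤ c.k → ∀ y z : Site d, y ∈ c.sq 0 → z ∉ c.sq 0 →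
      (∀ l, y l - 1 ≤ z l ∧ z l ≤ y l + 1) → y ∈ c.lamST m 0 := by
  have hL : Odd L := ⟨s, by omega⟩
  have hL2 : 2 ≤ L := by omega
  intro m hm1 hmk y z hy hz hyz
  set tK : Site d := fun _ => (ctrShift L c.k : ℤ) with htK
  have hy' := (add_ctrShift_mem_translate_sq_iff c hL 0 y).2 hy
  have hz' : z + tK ∉ (c.translate hL).sq 0 := fun h => hz ((add_ctrShift_mem_translate_sq_iff c hL 0 z).1 h)
  have hyz' : ∀ l, (y + tK) l - 1 ≤ (z + tK) l ∧ (z + tK) l ≤ (y + tK) l + 1 := fun l => by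
    obtain ⟨h1, h2⟩ := hyz l
    simp only [Pi.add_apply]
    exact ⟨by linarith, by linarith⟩
  have h := B8DentedCubeMemberLamBPrime.bdryLayer_dented (c.translate hL) hL2 m hm1 hmk _ _ hy' hz' hyz'
  have h0 : (c.k - 0) = c.k := Nat.sub_zero _
  rw [mem_lamST_iff_add_ctrShift c hL m 0 y, h0]
  exact h

end Laws

end Literature.MathematicalPhysics.QuantumFieldTheory.Balaban1983to89.B8DentedCubeMemberZdRec

end
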